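import Summits.CriticalPhenomena.Ising3DConformalLimit.Theses.SubPtolemyInterlacing
import Summits.CriticalPhenomena.Ising3DConformalLimit.Theorems.SubPtolemyInterlacingInterlacingAxisPair
import Summits.CriticalPhenomena.Ising3DConformalLimit.Theorems.SubPtolemyInterlacingInterlacingLogConvex
import Summits.CriticalPhenomena.Ising3DConformalLimit.Theorems.SubPtolemyInterlacingInterlacingMonotone
import Summits.CriticalPhenomena.Ising3DConformalLimit.Theorems.SubPtolemyInterlacingInterlacingLebowitzRegime
import Summits.CriticalPhenomena.Ising3DConformalLimit.Theorems.SubPtolemyInterlacingInterlacingBoxSwitching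
import Summits.CriticalPhenomena.Ising3DConformalLimit.Theorems.SubPtolemyInterlacingInterlacingBoxLimit
import Summits.CriticalPhenomena.Ising3DConformalLimit.Theorems.SubPtolemyInterlacingInterlacingGHSPivot
import Summits.CriticalPhenomena.Ising3DConformalLimit.Theorems.SubPtolemyInterlacingInterlacingGHSRegime
import Literature.Probability.LatticeModels.CriticalUrsellFourSign
import Literature.Probability.LatticeModels.CriticalAxisRatioRegularity
import HarnessLib

/-!
# Line `Sketch` for the crux `SubPtolemyInterlacing.Interlacing` (stmt-CriticalPhenomena-15702) — stub `stub_reduction`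

THE REDUCTION OF EACH INSTANCE OF THE CRUX TO THE ENGINE AT THAT INSTANCE, banked as a theorem (lead c7, 2026-08-17).
The line `Sketch` (`Cruxes/Interlacing/Lines/Sketch.lean`) treats the instance `(a,b,c)` of the sub-Ptolemy /
interlacing inequality `S₄ · P₂ ≤ P₁ · P₃` (`P₁ = G₁₂G₃₄` adjacent, `P₂ = G₁₃G₂₄` crossing, `P₃ = G₁₄G₂₃` nested;
`x₁ = 0, x₂ = a e₁, x₃ = (a+b) e₁, x₄ = (a+b+c) e₁ ∈ ℤ³`, `β = β_c(3)`) by a regime split, every branch of which except the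
engine is a landed theorem:

* the **GHS regime** `(P₁+P₂+P₃)P₂ − P₁P₃ ≤ 2·M·P₂` (`M` the best of the four pivot tree terms): closed at infinite volume by
  the GHS pivot floor (`stub_ghsPivot`, p155773) through `stub_ghsRegime` (p155710);
* the **Lebowitz corner** `2P₂² ≤ (P₁−P₂)(P₃−P₂)`: closed by Lebowitz' inequality (`stub_lebowitzRegime`, p129436) through the
  axis dictionary (`stub_axisPair`, p129148);
* the **hard core** (the window between the two): there the ENGINE hypothesis `hE` AT `(a,b,c)` — the interlaced-merging floor
  of the two sourced critical double currents in the free boxes `Λ_L`, in the pattern form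
  `P₂ᴸ(P₁ᴸ+P₂ᴸ+P₃ᴸ) − P₁ᴸP₃ᴸ ≤ 2(P₂ᴸ)²·𝐏^{x₁x₃,x₂x₄}_{Λ_L}[x₁ ↔ x₂]` eventually in `L`, granted axial monotonicity
  `P₂ ≤ P₁` (`stub_monotone`, p129318), log-convexity `P₂ ≤ P₃` (`stub_logConvex`, p129236) and the two negated regime
  criteria — combines with the box switching identity `S₄ᴸ = P₁ᴸ+P₂ᴸ+P₃ᴸ − 2P₂ᴸ·𝐏[x₁ ↔ x₂]` (`stub_boxSwitching`, p129565)
  to the box inequality `S₄ᴸP₂ᴸ ≤ P₁ᴸP₃ᴸ`, and the box limit (`stub_boxLimit`, p129649) transports it to the critical state.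

So `stub_reduction a b c : (engine at (a,b,c)) → SPC(a,b,c)`, instance by instance: whoever proves the engine on a family
of shapes gets the inequality on that family (e.g. the balanced shapes `(2N,N,3N)` of item stmt-CriticalPhenomena-18014
`InterlacingEventualBalanced`), and the engine for all gaps gives the crux `Interlacing` (the skeleton's
`Interlacing_proof := fun a b c ha hb hc ↦ stub_reduction a b c (stub_engineCore a b c ha hb hc)`). The engine itself is the
crux's open content (on the balanced family a scale-uniform `|U₄| ≥ 0.9·G₁₃G₂₄`, non-Gaussianity of critical 3D Ising with
a constant). Nothing here is conditional on a named fact.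

Helper file of the line `Sketch`: proves the registered stub `stub_reduction` verbatim (name + signature). No definitions,
no named facts, no sorry.
-/

noncomputable section

namespace Summit.CriticalPhenomena.Ising3DConformalLimit.Cruxes.Interlacing.Sketch

open Filter MeasureTheory
open scoped symmDiff Topology
open Literature.Probability.LatticeModels Literature.Probability.Percolation

/-- **Stub `stub_reduction` (each instance of the crux from the engine at that instance).** For gaps `a b c : ℕ`, if the
ENGINE holds at `(a,b,c)` — i.e. granted `P₂ ≤ P₁`, `P₂ ≤ P₃`, the window `(P₁ − P₂)(P₃ − P₂) < 2P₂²` and the negated GHS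
criterion `2·M·P₂ < (P₁+P₂+P₃)P₂ − P₁P₃` (all for the critical axial two-point function `criticalTwoPoint 3`), the pattern
inequality `P₂ᴸ(P₁ᴸ+P₂ᴸ+P₃ᴸ) − P₁ᴸP₃ᴸ ≤ 2(P₂ᴸ)² · 𝐏^{x₁x₃,x₂x₄}_{Λ_L,β_c}[x₁ ↔ x₂]` holds in the free boxes eventually in `L`
(verbatim the instance of the skeleton's `stub_engineCore`) — then the interlacing inequality holds at the axis quadruple
`(0, a, a+b, a+b+c)·e₁` for `criticalCorr 3`, in the crux's spelling. Proof: inside the GHS regime `stub_ghsRegime` fed with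
`stub_ghsPivot`; outside it, in the window the hypothesis with `stub_monotone`/`stub_logConvex`, the box identity
`stub_boxSwitching` and the box limit `stub_boxLimit`; in the Lebowitz corner `stub_lebowitzRegime` through the dictionary
`stub_axisPair`. -/
theorem stub_reduction : ∀ a b c : ℕ,
    (criticalTwoPoint 3 (Pi.single 0 ((a + b : ℕ) : ℤ)) * criticalTwoPoint 3 (Pi.single 0 ((b + c : ℕ) : ℤ)) ≤
      criticalTwoPoint 3 (Pi.single 0 ((a : ℕ) : ℤ)) * criticalTwoPoint 3 (Pi.single 0 ((c : ℕ) : ℤ)) →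
    criticalTwoPoint 3 (Pi.single 0 ((a + b : ℕ) : ℤ)) * criticalTwoPoint 3 (Pi.single 0 ((b + c : ℕ) : ℤ)) ≤
      criticalTwoPoint 3 (Pi.single 0 ((a + b + c : ℕ) : ℤ)) * criticalTwoPoint 3 (Pi.single 0 ((b : ℕ) : ℤ)) →
    (criticalTwoPoint 3 (Pi.single 0 ((a : ℕ) : ℤ)) * criticalTwoPoint 3 (Pi.single 0 ((c : ℕ) : ℤ)) -
          criticalTwoPoint 3 (Pi.single 0 ((a + b : ℕ) : ℤ)) * criticalTwoPoint 3 (Pi.single 0 ((b + c : ℕ) : ℤ))) *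
        (criticalTwoPoint 3 (Pi.single 0 ((a + b + c : ℕ) : ℤ)) * criticalTwoPoint 3 (Pi.single 0 ((b : ℕ) : ℤ)) -
          criticalTwoPoint 3 (Pi.single 0 ((a + b : ℕ) : ℤ)) * criticalTwoPoint 3 (Pi.single 0 ((b + c : ℕ) : ℤ))) <
      2 * (criticalTwoPoint 3 (Pi.single 0 ((a + b : ℕ) : ℤ)) * criticalTwoPoint 3 (Pi.single 0 ((b + c : ℕ) : ℤ))) ^ 2 →
    2 * max
          (max (criticalTwoPoint 3 (Pi.single 0 ((a : ℕ) : ℤ)) * criticalTwoPoint 3 (Pi.single 0 ((a + b : ℕ) : ℤ)) *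
              criticalTwoPoint 3 (Pi.single 0 ((a + b + c : ℕ) : ℤ)))
            (criticalTwoPoint 3 (Pi.single 0 ((a : ℕ) : ℤ)) * criticalTwoPoint 3 (Pi.single 0 ((b : ℕ) : ℤ)) *
              criticalTwoPoint 3 (Pi.single 0 ((b + c : ℕ) : ℤ))))
          (max (criticalTwoPoint 3 (Pi.single 0 ((a + b : ℕ) : ℤ)) * criticalTwoPoint 3 (Pi.single 0 ((b : ℕ) : ℤ)) *
              criticalTwoPoint 3 (Pi.single 0 ((c : ℕ) : ℤ)))
            (criticalTwoPoint 3 (Pi.single 0 ((a + b + c : ℕ) : ℤ)) * criticalTwoPoint 3 (Pi.single 0 ((b + c : ℕ) : ℤ)) *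
              criticalTwoPoint 3 (Pi.single 0 ((c : ℕ) : ℤ)))) *
        (criticalTwoPoint 3 (Pi.single 0 ((a + b : ℕ) : ℤ)) * criticalTwoPoint 3 (Pi.single 0 ((b + c : ℕ) : ℤ))) <
      (criticalTwoPoint 3 (Pi.single 0 ((a : ℕ) : ℤ)) * criticalTwoPoint 3 (Pi.single 0 ((c : ℕ) : ℤ)) +
          criticalTwoPoint 3 (Pi.single 0 ((a + b : ℕ) : ℤ)) * criticalTwoPoint 3 (Pi.single 0 ((b + c : ℕ) : ℤ)) +
          criticalTwoPoint 3 (Pi.single 0 ((a + b + c : ℕ) : ℤ)) * criticalTwoPoint 3 (Pi.single 0 ((b : ℕ) : ℤ))) *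
        (criticalTwoPoint 3 (Pi.single 0 ((a + b : ℕ) : ℤ)) * criticalTwoPoint 3 (Pi.single 0 ((b + c : ℕ) : ℤ))) -
      criticalTwoPoint 3 (Pi.single 0 ((a : ℕ) : ℤ)) * criticalTwoPoint 3 (Pi.single 0 ((c : ℕ) : ℤ)) *
        (criticalTwoPoint 3 (Pi.single 0 ((a + b + c : ℕ) : ℤ)) * criticalTwoPoint 3 (Pi.single 0 ((b : ℕ) : ℤ))) →
    ∀ᶠ L : ℕ in atTop,
      isingTwoPoint (zdGraph 3) (box 3 L) (criticalBeta 3) 0 .free (Pi.single 0 ((0 : ℕ) : ℤ)) (Pi.single 0 ((a + b : ℕ) : ℤ)) *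
            isingTwoPoint (zdGraph 3) (box 3 L) (criticalBeta 3) 0 .free (Pi.single 0 ((a : ℕ) : ℤ)) (Pi.single 0 ((a + b + c : ℕ) : ℤ)) *
          (isingTwoPoint (zdGraph 3) (box 3 L) (criticalBeta 3) 0 .free (Pi.single 0 ((0 : ℕ) : ℤ)) (Pi.single 0 ((a : ℕ) : ℤ)) *
            isingTwoPoint (zdGraph 3) (box 3 L) (criticalBeta 3) 0 .free (Pi.single 0 ((a + b : ℕ) : ℤ)) (Pi.single 0 ((a + b + c : ℕ) : ℤ)) +
            isingTwoPoint (zdGraph 3) (box 3 L) (criticalBeta 3) 0 .free (Pi.single 0 ((0 : ℕ) : ℤ)) (Pi.single 0 ((a + b : ℕ) : ℤ)) *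
            isingTwoPoint (zdGraph 3) (box 3 L) (criticalBeta 3) 0 .free (Pi.single 0 ((a : ℕ) : ℤ)) (Pi.single 0 ((a + b + c : ℕ) : ℤ)) +
            isingTwoPoint (zdGraph 3) (box 3 L) (criticalBeta 3) 0 .free (Pi.single 0 ((0 : ℕ) : ℤ)) (Pi.single 0 ((a + b + c : ℕ) : ℤ)) *
            isingTwoPoint (zdGraph 3) (box 3 L) (criticalBeta 3) 0 .free (Pi.single 0 ((a : ℕ) : ℤ)) (Pi.single 0 ((a + b : ℕ) : ℤ))) -
        isingTwoPoint (zdGraph 3) (box 3 L) (criticalBeta 3) 0 .free (Pi.single 0 ((0 : ℕ) : ℤ)) (Pi.single 0 ((a : ℕ) : ℤ)) *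
            isingTwoPoint (zdGraph 3) (box 3 L) (criticalBeta 3) 0 .free (Pi.single 0 ((a + b : ℕ) : ℤ)) (Pi.single 0 ((a + b + c : ℕ) : ℤ)) *
          (isingTwoPoint (zdGraph 3) (box 3 L) (criticalBeta 3) 0 .free (Pi.single 0 ((0 : ℕ) : ℤ)) (Pi.single 0 ((a + b + c : ℕ) : ℤ)) *
            isingTwoPoint (zdGraph 3) (box 3 L) (criticalBeta 3) 0 .free (Pi.single 0 ((a : ℕ) : ℤ)) (Pi.single 0 ((a + b : ℕ) : ℤ))) ≤
      2 * (isingTwoPoint (zdGraph 3) (box 3 L) (criticalBeta 3) 0 .free (Pi.single 0 ((0 : ℕ) : ℤ)) (Pi.single 0 ((a + b : ℕ) : ℤ)) *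
            isingTwoPoint (zdGraph 3) (box 3 L) (criticalBeta 3) 0 .free (Pi.single 0 ((a : ℕ) : ℤ)) (Pi.single 0 ((a + b + c : ℕ) : ℤ))) ^ 2 *
          (sourcedDoubleCurrentLaw 3 L (criticalBeta 3) ({(Pi.single 0 ((0 : ℕ) : ℤ))} ∆ {(Pi.single 0 ((a + b : ℕ) : ℤ))})
            ({(Pi.single 0 ((a : ℕ) : ℤ))} ∆ {(Pi.single 0 ((a + b + c : ℕ) : ℤ))})).real (openConn (Pi.single 0 ((0 : ℕ) : ℤ)) (Pi.single 0 ((a : ℕ) : ℤ)))) →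
      criticalCorr 3 4 ![((0 : ℕ) : ℤ) • (Pi.single 0 1 : Site 3), ((a : ℕ) : ℤ) • (Pi.single 0 1 : Site 3), ((a + b : ℕ) : ℤ) • (Pi.single 0 1 : Site 3),
          ((a + b + c : ℕ) : ℤ) • (Pi.single 0 1 : Site 3)] *
          (criticalCorr 3 2 ![((0 : ℕ) : ℤ) • (Pi.single 0 1 : Site 3), ((a + b : ℕ) : ℤ) • (Pi.single 0 1 : Site 3)] *
            criticalCorr 3 2 ![((a : ℕ) : ℤ) • (Pi.single 0 1 : Site 3), ((a + b + c : ℕ) : ℤ) • (Pi.single 0 1 : Site 3)]) ≤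
        criticalCorr 3 2 ![((0 : ℕ) : ℤ) • (Pi.single 0 1 : Site 3), ((a : ℕ) : ℤ) • (Pi.single 0 1 : Site 3)] *
            criticalCorr 3 2 ![((a + b : ℕ) : ℤ) • (Pi.single 0 1 : Site 3), ((a + b + c : ℕ) : ℤ) • (Pi.single 0 1 : Site 3)] *
          (criticalCorr 3 2 ![((0 : ℕ) : ℤ) • (Pi.single 0 1 : Site 3), ((a + b + c : ℕ) : ℤ) • (Pi.single 0 1 : Site 3)] *
            criticalCorr 3 2 ![((a : ℕ) : ℤ) • (Pi.single 0 1 : Site 3), ((a + b : ℕ) : ℤ) • (Pi.single 0 1 : Site 3)]) := by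
  intro a b c hE
  by_cases hghs :
    (criticalTwoPoint 3 (Pi.single 0 ((a : ℕ) : ℤ)) * criticalTwoPoint 3 (Pi.single 0 ((c : ℕ) : ℤ)) +
          criticalTwoPoint 3 (Pi.single 0 ((a + b : ℕ) : ℤ)) * criticalTwoPoint 3 (Pi.single 0 ((b + c : ℕ) : ℤ)) +
          criticalTwoPoint 3 (Pi.single 0 ((a + b + c : ℕ) : ℤ)) * criticalTwoPoint 3 (Pi.single 0 ((b : ℕ) : ℤ))) *
        (criticalTwoPoint 3 (Pi.single 0 ((a + b : ℕ) : ℤ)) * criticalTwoPoint 3 (Pi.single 0 ((b + c : ℕ) : ℤ))) -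
      criticalTwoPoint 3 (Pi.single 0 ((a : ℕ) : ℤ)) * criticalTwoPoint 3 (Pi.single 0 ((c : ℕ) : ℤ)) *
        (criticalTwoPoint 3 (Pi.single 0 ((a + b + c : ℕ) : ℤ)) * criticalTwoPoint 3 (Pi.single 0 ((b : ℕ) : ℤ))) ≤
      2 * max
          (max (criticalTwoPoint 3 (Pi.single 0 ((a : ℕ) : ℤ)) * criticalTwoPoint 3 (Pi.single 0 ((a + b : ℕ) : ℤ)) *
              criticalTwoPoint 3 (Pi.single 0 ((a + b + c : ℕ) : ℤ)))
            (criticalTwoPoint 3 (Pi.single 0 ((a : ℕ) : ℤ)) * criticalTwoPoint 3 (Pi.single 0 ((b : ℕ) : ℤ)) *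
              criticalTwoPoint 3 (Pi.single 0 ((b + c : ℕ) : ℤ))))
          (max (criticalTwoPoint 3 (Pi.single 0 ((a + b : ℕ) : ℤ)) * criticalTwoPoint 3 (Pi.single 0 ((b : ℕ) : ℤ)) *
              criticalTwoPoint 3 (Pi.single 0 ((c : ℕ) : ℤ)))
            (criticalTwoPoint 3 (Pi.single 0 ((a + b + c : ℕ) : ℤ)) * criticalTwoPoint 3 (Pi.single 0 ((b + c : ℕ) : ℤ)) *
              criticalTwoPoint 3 (Pi.single 0 ((c : ℕ) : ℤ)))) *
        (criticalTwoPoint 3 (Pi.single 0 ((a + b : ℕ) : ℤ)) * criticalTwoPoint 3 (Pi.single 0 ((b + c : ℕ) : ℤ)))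
  · -- the GHS regime: the pivot floor closes the instance at infinite volume
    exact stub_ghsRegime stub_ghsPivot a b c hghs
  push Not at hghs
  -- the six infinite-volume pair correlators through the dictionary
  have h0a := stub_axisPair 0 a (Nat.zero_le _)
  have h0ab := stub_axisPair 0 (a + b) (Nat.zero_le _)
  have h0abc := stub_axisPair 0 (a + b + c) (Nat.zero_le _)
  have haabc := stub_axisPair a (a + b + c) (by omega)
  have habab := stub_axisPair (a + b) (a + b + c) (by omega)
  have haab := stub_axisPair a (a + b) (by omega)
  rw [Nat.sub_zero] at h0a h0ab h0abc
  rw [show a + b + c - a = b + c by omega] at haabc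
  rw [show a + b + c - (a + b) = c by omega] at habab
  rw [show a + b - a = b by omega] at haab
  by_cases hwin :
    (criticalTwoPoint 3 (Pi.single 0 ((a : ℕ) : ℤ)) * criticalTwoPoint 3 (Pi.single 0 ((c : ℕ) : ℤ)) -
          criticalTwoPoint 3 (Pi.single 0 ((a + b : ℕ) : ℤ)) * criticalTwoPoint 3 (Pi.single 0 ((b + c : ℕ) : ℤ))) *
        (criticalTwoPoint 3 (Pi.single 0 ((a + b + c : ℕ) : ℤ)) * criticalTwoPoint 3 (Pi.single 0 ((b : ℕ) : ℤ)) -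
          criticalTwoPoint 3 (Pi.single 0 ((a + b : ℕ) : ℤ)) * criticalTwoPoint 3 (Pi.single 0 ((b + c : ℕ) : ℤ))) <
      2 * (criticalTwoPoint 3 (Pi.single 0 ((a + b : ℕ) : ℤ)) * criticalTwoPoint 3 (Pi.single 0 ((b + c : ℕ) : ℤ))) ^ 2
  · -- the window on the hard core: engine + box identity, then the box limit
    have hev := hE (stub_monotone a b c) (stub_logConvex a b c) hwin hghs
    refine stub_boxLimit a b c ?_
    filter_upwards [hev, eventually_ge_atTop (a + b + c)] with L hL hLabc
    rw [stub_boxSwitching L a b c hLabc]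
    nlinarith [hL]
  · -- the Lebowitz corner
    push Not at hwin
    refine stub_lebowitzRegime a b c ?_
    rw [h0a, h0ab, h0abc, haabc, habab, haab]
    exact hwin


end Summit.CriticalPhenomena.Ising3DConformalLimit.Cruxes.Interlacing.Sketch

end
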